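import Literature.AnabelianGeometry.EtaleTheta.SettingModelChiTwistedLatticeYCoord
import Literature.AnabelianGeometry.EtaleTheta.EtaleThetaDataOfClass
import HarnessLib

/-!
# The χ-twisted root model with an extra Tate lattice, file 2: the KUMMER CORE, the Kummer data and an étale theta datum
# of `ThetaSetting.modelLat` (F-2633 closure certificate «F2633-SWAP-TOWER»)

Mochizuki, *The étale theta function …*, Publ. RIMS **45** (2009) [EtTh], §1, Prop. 1.3 / 1.5, PRIMS PDF pp. 21–23
[cite: MochizukiEtTh2009, Prop 1.5 p.23]: "the Kummer map `K^× → H¹(G_K, Δ_Θ)`", "`log(U)`, `log(Ü)`", "`log(U)|_Ÿ = 2·log(Ü)`".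

LATTICE TWIST OF `Ẑ(1)²` — NOT the (B) section twist (cf. file 1, `SettingModelChiTwistedLattice.lean`, and abc-iut-L2-lead
R709).  abc-iut cell, K-L6 slice, row «KL6-CLOSURE-CERT F-2633», seat abc-iut-L6-t19 (gen 8).  Verbatim mirror of abc-iut-w5-d171's
`kummerCoreχ` (`SettingModelChiKummerData`) for the lattice model, BY NAME over files 1–2c:

* `logULat` — the class of `g ↦ coord(ŷ□(g))` on `(Π□_Y)^Θ` (cocycle law from `yThetaLat_mul` + `deltaThetaCoordLat_chi`);
  `logUddLat` — the class of `g ↦ coord(ŷ□(g)/2)` on `(Π□_Ÿ)^Θ`, where `ŷ□ = ê_b(γ)·t₁` is a SQUARE exactly because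
  `Π□_Ÿ = {y₂(γ) + ℓ₂(t₁) = 0}` (`yThetaLat_mem_range_sqHom`); `res_logULat`;
* **`kummerCoreLat p : (ThetaSetting.modelLat p).KummerCore`** (`augTheta := CurveTheta.augTheta curveLat`, `coeffHom :=
  deltaThetaCoordLat ∘ cycEquiv`, Galois images by the generic root facts), **`kummerDataLat`**, and
  **`etaleThetaDataLat := etaleThetaDataOfClass _ 1`** — so `E□ : (modelLat p).EtaleThetaData` EXISTS (input of file 3).

HONEST LABEL: semi-synthetic model — consistency/independence evidence for OUR typed interface only; nothing of [EtTh] asserted;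
decides (H1)/F-2633 at no genuine instance; no side taken on [IUTchIII] Cor. 3.12.  Class (b) construction file (def-bearing;
instances only re-key the generic `DeltaTheta` Normal/commutative instances at the NEW carrier, as `SettingModelChiKummerData`
does for `modelχ`; no notation, no Prop-valued def).
-/

noncomputable section

namespace Literature.AnabelianGeometry.EtaleTheta.SettingModel

open Literature.AnabelianGeometry.SemiGraphs _root_.Topology _root_.Function

variable (p : ℕ) [Fact p.Prime]

/-! ### Instance keys at the concrete carrier (cf. `SettingModelChiKummerData`) -/

/-- `Δ_Θ(curveLat)` is commutative — the generic `ThetaSetting.deltaTheta_comm`, RE-KEYED at the concrete quotient carrier so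
that instance search finds it (the lattice model is a reducible structure literal). [cite: MochizukiEtTh2009, §1 p.12] -/
instance deltaThetaLat_isMulCommutative : IsMulCommutative (CurveTheta.thetaToEll (curveLat p)).ker :=
  ThetaSetting.deltaTheta_comm (ThetaSetting.modelLat p)

/-- `Δ_Θ(modelLat) ⊴ (Π^tp_X□)^Θ`, keyed on `(modelLat p).DeltaTheta`. [cite: MochizukiEtTh2009, §1 p.12] -/
instance deltaTheta_modelLat_normal : (ThetaSetting.modelLat p).DeltaTheta.Normal :=
  ThetaSetting.deltaTheta_normal _

/-- `Δ_Θ(modelLat)` is commutative, keyed on `(modelLat p).DeltaTheta`. [cite: MochizukiEtTh2009, §1 p.12] -/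
instance deltaTheta_modelLat_isMulCommutative : IsMulCommutative (ThetaSetting.modelLat p).DeltaTheta :=
  ThetaSetting.deltaTheta_comm _

/-! ### The `log(U)` and `log(Ü)` cocycles -/

/-- **The `log(U)`-cocycle** `g ↦ coord(ŷ□(g)) ∈ Δ_Θ(curveLat)` on a subgroup `H ≤ (Π^tp_X□)^Θ`. [cite: MochizukiEtTh2009, Prop 1.5 p.23] -/
def logUFunLat (H : Subgroup (CurveTheta.GTheta (curveLat p))) : H → (CurveTheta.thetaToEll (curveLat p)).ker :=
  fun h => deltaThetaCoordLat p (yThetaLat p h)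

/-- It is a continuous 1-cocycle for the conjugation action on `Δ_Θ`. [cite: MochizukiEtTh2009, Prop 1.5 p.23] -/
theorem logUFunLat_mem (H : Subgroup (CurveTheta.GTheta (curveLat p))) :
    logUFunLat p H ∈ contCocycles (MonoidHom.id (CurveTheta.GTheta (curveLat p)))
      (CurveTheta.thetaToEll (curveLat p)).ker H := by
  refine ⟨(continuous_deltaThetaCoordLat p).comp ((continuous_yThetaLat p).comp continuous_subtype_val), fun g h => ?_⟩
  show deltaThetaCoordLat p (yThetaLat p ((g : CurveTheta.GTheta (curveLat p)) * h)) =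
    deltaThetaCoordLat p (yThetaLat p g) *
      MulAut.conjNormal ((MonoidHom.id _) (g : CurveTheta.GTheta (curveLat p))) (deltaThetaCoordLat p (yThetaLat p h))
  rw [yThetaLat_mul, map_mul, MonoidHom.id_apply, ← deltaThetaCoordLat_chi]

/-- On `(Π□_Ÿ)^Θ` the twisted `y`-coordinate `ŷ□ = ê_b(γ)·t₁` is a SQUARE (`Π□_Ÿ = Π□_{Y_2} = {y₂(γ) + ℓ₂(t₁) = 0}`).
[cite: MochizukiEtTh2009, Prop 1.5 p.23] -/
theorem yThetaLat_mem_range_sqHom {x : CurveTheta.GTheta (curveLat p)}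
    (hx : x ∈ (ThetaSetting.modelLat p).GtpYdd.map (ThetaSetting.modelLat p).toTheta) : yThetaLat p x ∈ sqHom.range := by
  obtain ⟨g, hg, rfl⟩ := hx
  have hg2 : g ∈ YNLat p 2 := by
    have h' : g ∈ (ThetaSetting.modelLat p).GtpYN (2 * 1) := (Subgroup.mem_inf.mp hg).1
    simpa using h'
  have hpsi : psiLat 2 g.left = 1 := ((mem_AYLat_iff 2 g.left).mp ((mem_YNLat_iff p).mp hg2).1).2
  show yCoordLat p g ∈ sqHom.range
  rw [mem_range_sqHom_iff, yCoordLat_apply, map_mul, ← hHat_y_eq_modN_eHatB, modN_eq_level]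
  exact hpsi

/-- **The `log(Ü)`-cocycle** `g ↦ coord(ŷ□(g)/2)` on `(Π□_Ÿ)^Θ`. [cite: MochizukiEtTh2009, Prop 1.5 p.23] -/
def logUddFunLat : ((ThetaSetting.modelLat p).GtpYdd.map (ThetaSetting.modelLat p).toTheta) →
    (CurveTheta.thetaToEll (curveLat p)).ker :=
  fun h => deltaThetaCoordLat p (half ⟨yThetaLat p h, yThetaLat_mem_range_sqHom p h.2⟩)

/-- It is a continuous 1-cocycle. [cite: MochizukiEtTh2009, Prop 1.5 p.23] -/
theorem logUddFunLat_mem :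
    logUddFunLat p ∈ contCocycles (MonoidHom.id (CurveTheta.GTheta (curveLat p)))
      (CurveTheta.thetaToEll (curveLat p)).ker ((ThetaSetting.modelLat p).GtpYdd.map (ThetaSetting.modelLat p).toTheta) := by
  refine ⟨(continuous_deltaThetaCoordLat p).comp (continuous_half.comp
    (((continuous_yThetaLat p).comp continuous_subtype_val).subtype_mk _)), fun g h => ?_⟩
  show deltaThetaCoordLat p (half ⟨yThetaLat p ((g : CurveTheta.GTheta (curveLat p)) * h), _⟩) =
    deltaThetaCoordLat p (half ⟨yThetaLat p g, _⟩) *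
      MulAut.conjNormal ((MonoidHom.id _) (g : CurveTheta.GTheta (curveLat p))) (deltaThetaCoordLat p (half ⟨yThetaLat p h, _⟩))
  rw [MonoidHom.id_apply, ← deltaThetaCoordLat_chi, ← map_mul, ← half_mulAut, ← map_mul]
  congr 1
  apply sqHom_injective
  rw [sqHom_apply, sqHom_apply, half_sq, half_sq]
  exact yThetaLat_mul p g h

/-- **`log(U) ∈ H¹((Π□_Y)^Θ, Δ_Θ)`** at the lattice model. [cite: MochizukiEtTh2009, Prop 1.5 p.23] -/
def logULat : (ThetaSetting.modelLat p).H1Theta ((ThetaSetting.modelLat p).GtpY.map (ThetaSetting.modelLat p).toTheta) :=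
  ContH1.mk (logUFunLat p _) (logUFunLat_mem p _)

/-- **`log(Ü) ∈ H¹((Π□_Ÿ)^Θ, Δ_Θ)`** at the lattice model. [cite: MochizukiEtTh2009, Prop 1.5 p.23] -/
def logUddLat : (ThetaSetting.modelLat p).H1Theta ((ThetaSetting.modelLat p).GtpYdd.map (ThetaSetting.modelLat p).toTheta) :=
  ContH1.mk (logUddFunLat p) (logUddFunLat_mem p)

/-- **`log(U)|_Ÿ = 2 · log(Ü)`** at the lattice model. [cite: MochizukiEtTh2009, Prop 1.5 p.23] -/
theorem res_logULat :
    ContH1.res (MonoidHom.id (ThetaSetting.modelLat p).GtpTheta) (ThetaSetting.modelLat p).DeltaTheta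
        (ThetaSetting.modelLat p).GtpYddTheta_le (logULat p) = logUddLat p ^ 2 := by
  rw [logUddLat, pow_two, ContH1.mk_mul_mk]
  refine ContH1.mk_congr _ (funext fun h => ?_) _ _
  show deltaThetaCoordLat p (yThetaLat p h) =
    deltaThetaCoordLat p (half ⟨yThetaLat p h, _⟩) * deltaThetaCoordLat p (half ⟨yThetaLat p h, _⟩)
  rw [← map_mul, ← pow_two, half_sq]

/-! ### The Kummer core, the Kummer data, an étale theta datum -/

/-- **The Kummer core of the lattice-twisted root model.** [cite: MochizukiEtTh2009, Prop 1.5 p.23] -/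
def kummerCoreLat : (ThetaSetting.modelLat p).KummerCore where
  augTheta := CurveTheta.augTheta (curveLat p)
  continuous_augTheta := CurveTheta.continuous_augTheta (curveLat p)
  augTheta_toTheta _ := rfl
  coeffHom := (deltaThetaCoordLat p).comp (cycEquiv p).toMonoidHom
  continuous_coeffHom := (continuous_deltaThetaCoordLat p).comp (continuous_cycEquiv p)
  coeffHom_smul g ζ := by
    show deltaThetaCoordLat p (cycEquiv p (CurveTheta.augTheta (curveLat p) g • ζ)) =
      MulAut.conjNormal g (deltaThetaCoordLat p (cycEquiv p ζ))
    rw [cycEquiv_smul, deltaThetaCoordLat_chi]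
  bijective_coeffHom := (bijective_deltaThetaCoordLat p).comp (cycEquiv p).bijective
  map_augTheta_gtpY :=
    (ThetaSetting.modelLat p).map_map_gtpY_of_comp_eq _ (CurveTheta.augTheta_comp_toTheta (curveLat p))
  map_augTheta_gtpYdd :=
    (ThetaSetting.modelLat p).map_map_gtpYdd_of_comp_eq _ (CurveTheta.augTheta_comp_toTheta (curveLat p))
  finiteDimensional_Kdd :=
    (ThetaSetting.modelLat p).finiteDimensional_Kdd_of_sqrtqX_mem (natCast_mem ⊥ p)
  logU := logULat p
  logUdd := logUddLat p
  res_logU := res_logULat p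

/-- **The Kummer data of the lattice-twisted root model.** [cite: MochizukiEtTh2009, Prop 1.5 p.23] -/
def kummerDataLat : (ThetaSetting.modelLat p).KummerData := (kummerCoreLat p).toKummerData

/-- `ThetaSetting.modelLat` carries Kummer data. [cite: MochizukiEtTh2009, Prop 1.5 p.23] -/
theorem nonempty_kummerData_modelLat : Nonempty (ThetaSetting.modelLat p).KummerData := ⟨kummerDataLat p⟩

/-- **An étale theta datum of the lattice-twisted root model** (abc-iut-L2-t6's `etaleThetaDataOfClass` at the class `1`):
the carrier over which file 3 chooses the covering `X̲̲□`. [cite: MochizukiEtTh2009, Prop 1.3 p.21] -/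
def etaleThetaDataLat : (ThetaSetting.modelLat p).EtaleThetaData :=
  ThetaSetting.KummerData.etaleThetaDataOfClass (kummerDataLat p) 1

/-- `ThetaSetting.modelLat` carries étale theta data. [cite: MochizukiEtTh2009, Prop 1.3 p.21] -/
theorem nonempty_etaleThetaData_modelLat : Nonempty (ThetaSetting.modelLat p).EtaleThetaData := ⟨etaleThetaDataLat p⟩

end Literature.AnabelianGeometry.EtaleTheta.SettingModel

end
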